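import Summits.RiemannHypothesis.RiemannHypothesis.Theorems.WeilFormatCLogTrigTailSums
import Summits.RiemannHypothesis.RiemannHypothesis.Theorems.WeilFormatCLogTailSums
import Summits.RiemannHypothesis.RiemannHypothesis.Theorems.WeilFormatCOscTailAbelReal
import Literature.Analysis.ValidatedNumerics.MultiPrecisionInterval
import HarnessLib

/-!
# Format C, design C∞ (E2c, data side): one-fold Abel FAR-TAIL boxes for the `log`- and `log²`-weighted trigonometric Hankel entries

Route context: Fourier–Galerkin / Schur-complement certificates of Weil positivity on a window ("format C", C∞ door;
cell memo `run/shared/lean/pub/rh-explicit/rh-explicit-weil-2/gen15/E2-PLAN-v2.md` §6.4 (2)/§6.5; supporting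
stmt-RiemannHypothesis-0098; seat rh-explicit-weil-2).  The Hankel entries pairing the `log m` tag with `C_m`/`S_m` (and, after
product-to-sum, the `log²`-weighted ones) have far tails `Σ'_k log^i(B₄+k)·{cos,sin}((B₄+k)φ)·(m₀/(B₄+k))^s`, `i = 1, 2`.  For these
the tree has ONE-fold Abel summation (`WeilFormatCLogTrigTailSums`: `|Σ_{m∈Ico M N} log^i m/m^{k+1}·cos(mφ)| ≤ (log^i M/M^{k+1})/|sin(φ/2)|`
uniformly in `N`); gen9's rehearsal j194161 showed these crude radii suffice (even from B₃ = 256, odd from 512) once the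
pure-weighted trig entries are tight (`WeilFormatCCinfTrigTails`).  This file turns them into symmetric fixed-point boxes:

* `CinfCoeff.abs_tsum_le_of_abs_sum_range_le` — a uniform bound on the partial sums bounds the sum;
* `CinfCoeff.logTrigFarScaledBox S Ke ke Kl piI Φ σ m₀ B₄ s i = some ⟨−e, e⟩`, `e = ⌈R·S⌉`,
  `R = (L.hi/S)^i·m₀^s/(B₄^s·σ)` with `L ∋ log B₄` (`MI.logNat`) and a CLAIMED rational `σ ≤ |sin(φ/2)|` that the function CHECKS
  against the box `N ∋ |1 − e^{iφ}|² = 4 sin²(φ/2)` (`4σ²S ≤ N.lo`, decidable; `e^{iφ}` by `MC.expI` from `piI ∋ π`, `Φ ∋ φ`);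
* `CinfCoeff.mem_logTrigFarScaledBox` — the box encloses BOTH tails (`i ∈ {1,2}`, `B₄ ≥ 3`, `s ≥ 2`).

Interval plumbing only; standard axioms; no RH claim.
-/

set_option autoImplicit false
-- `Summit.RiemannHypothesis.RiemannHypothesis.…` is the layout-mandated namespace (summit = problem name).
set_option linter.dupNamespace false

open Complex Filter Topology

namespace Summit.RiemannHypothesis.RiemannHypothesis.Theorems.WeilFormatC

open Literature.Analysis.ValidatedNumerics Literature.Analysis.ValidatedNumerics.NumericsMP

namespace CinfCoeff

variable {S : ℕ}

/-- A uniform bound on the partial sums of a summable real series bounds the sum. -/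
theorem abs_tsum_le_of_abs_sum_range_le {f : ℕ → ℝ} (hs : Summable f) {C : ℝ}
    (h : ∀ n, |∑ j ∈ Finset.range n, f j| ≤ C) : |∑' j, f j| ≤ C :=
  le_of_tendsto' hs.tendsto_sum_tsum_nat.abs fun n ↦ h n

/-- **One-fold Abel far-tail box for the `log^i`-weighted trig tails** (see the module doc): `some ⟨−e, e⟩` or `none`. -/
def logTrigFarScaledBox (S Ke ke Kl : ℕ) (piI Φ : MI) (σ : ℚ) (m₀ B₄ s i : ℕ) : Option MI :=
  match MC.expI S Ke ke piI Φ, MI.logNat S Kl B₄ with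
  | some Z, some L =>
    if 0 < σ ∧ 4 * σ ^ 2 * (S : ℚ) ≤ ((MC.normSq S ((MC.ofInt S 1).sub Z)).lo : ℚ) then
      some ⟨-⌈((L.hi : ℚ) / S) ^ i * (m₀ : ℚ) ^ s / ((B₄ : ℚ) ^ s * σ) * S⌉,
        ⌈((L.hi : ℚ) / S) ^ i * (m₀ : ℚ) ^ s / ((B₄ : ℚ) ^ s * σ) * S⌉⟩
    else none
  | _, _ => none

/-- The uniform partial-sum bound behind both tails: for `i ∈ {1,2}`, `3 ≤ B₄`, `1 ≤ k`, trig = `cos` or `sin`. -/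
private theorem abs_sum_range_logPow_trig_le {φ : ℝ} (hφ : Real.sin (φ / 2) ≠ 0) {k B₄ i : ℕ} (hk : 1 ≤ k)
    (hB₄ : 3 ≤ B₄) (hi : i = 1 ∨ i = 2) (trig : ℝ → ℝ) (htrig : trig = Real.cos ∨ trig = Real.sin) (n : ℕ) :
    |∑ j ∈ Finset.range n, Real.log (((B₄ + j : ℕ)) : ℝ) ^ i / (((B₄ + j : ℕ)) : ℝ) ^ (k + 1)
        * trig ((((B₄ + j : ℕ)) : ℝ) * φ)|
      ≤ (Real.log B₄ ^ i / (B₄ : ℝ) ^ (k + 1)) / |Real.sin (φ / 2)| := by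
  have e : (∑ j ∈ Finset.range n, Real.log (((B₄ + j : ℕ)) : ℝ) ^ i / (((B₄ + j : ℕ)) : ℝ) ^ (k + 1)
        * trig ((((B₄ + j : ℕ)) : ℝ) * φ))
      = ∑ m ∈ Finset.Ico B₄ (B₄ + n), Real.log (m : ℝ) ^ i / (m : ℝ) ^ (k + 1) * trig ((m : ℝ) * φ) := by
    rw [Finset.sum_Ico_eq_sum_range, Nat.add_sub_cancel_left]
  rw [e]
  rcases hi with rfl | rfl
  · simp only [pow_one]
    rcases htrig with rfl | rfl
    · exact abs_sum_Ico_log_div_pow_mul_cos_le hφ hk (by omega) _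
    · exact abs_sum_Ico_log_div_pow_mul_sin_le hφ hk (by omega) _
  · rcases htrig with rfl | rfl
    · exact abs_sum_Ico_logSq_div_pow_mul_cos_le hφ hk hB₄ _
    · exact abs_sum_Ico_logSq_div_pow_mul_sin_le hφ hk hB₄ _

/-- Summability of `log^i(B₄+j)/(B₄+j)^{k+1}·trig((B₄+j)φ)` (`|trig| ≤ 1`). -/
private theorem summable_logPow_trig {φ : ℝ} {k B₄ i : ℕ} (hk : 1 ≤ k) (hB₄ : 4 ≤ B₄) (hi : i = 1 ∨ i = 2)
    (trig : ℝ → ℝ) (htrig : trig = Real.cos ∨ trig = Real.sin) :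
    Summable fun j : ℕ ↦ Real.log (((B₄ + j : ℕ)) : ℝ) ^ i / (((B₄ + j : ℕ)) : ℝ) ^ (k + 1)
      * trig ((((B₄ + j : ℕ)) : ℝ) * φ) := by
  have hg : Summable fun j : ℕ ↦ Real.log (((B₄ + j : ℕ)) : ℝ) ^ i / (((B₄ + j : ℕ)) : ℝ) ^ (k + 1) := by
    rcases hi with rfl | rfl
    · have h := (summable_log_div_add_pow hk (B₃ := B₄) (by omega)).1
      simp only [pow_one]
      convert h using 2 with j
      push_cast; ring
    · have h := (summable_logSq_div_add_pow hk (B₃ := B₄) hB₄).1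
      convert h using 2 with j
      push_cast; ring
  refine Summable.of_norm_bounded hg fun j ↦ ?_
  rw [Real.norm_eq_abs, abs_mul]
  have h1 : |trig ((((B₄ + j : ℕ)) : ℝ) * φ)| ≤ 1 := by
    rcases htrig with rfl | rfl
    · exact Real.abs_cos_le_one _
    · exact Real.abs_sin_le_one _
  have h0 : 0 ≤ Real.log (((B₄ + j : ℕ)) : ℝ) ^ i / (((B₄ + j : ℕ)) : ℝ) ^ (k + 1) := by
    have : (1 : ℝ) ≤ ((B₄ + j : ℕ) : ℝ) := by exact_mod_cast (show 1 ≤ B₄ + j by omega)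
    have := Real.log_nonneg this
    positivity
  rw [abs_of_nonneg h0]
  exact mul_le_of_le_one_right h0 h1

/-- **`logTrigFarScaledBox` encloses both `log^i`-weighted trig far tails** (`i ∈ {1,2}`, `B₄ ≥ 4`, `s ≥ 2`). -/
theorem mem_logTrigFarScaledBox (hS : 0 < S) {Ke ke Kl : ℕ} {piI Φ : MI} (hpi : MI.mem S Real.pi piI) {φ : ℝ}
    (hφm : MI.mem S φ Φ) {σ : ℚ} {m₀ B₄ s i : ℕ} (hB₄ : 4 ≤ B₄) (hs : 2 ≤ s) (hi : i = 1 ∨ i = 2) {B : MI}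
    (h : logTrigFarScaledBox S Ke ke Kl piI Φ σ m₀ B₄ s i = some B) :
    MI.mem S (∑' k : ℕ, Real.log ((B₄ + k : ℕ) : ℝ) ^ i * Real.cos ((B₄ + k : ℕ) * φ)
        * ((m₀ : ℝ) / ((B₄ + k : ℕ) : ℝ)) ^ s) B ∧
      MI.mem S (∑' k : ℕ, Real.log ((B₄ + k : ℕ) : ℝ) ^ i * Real.sin ((B₄ + k : ℕ) * φ)
        * ((m₀ : ℝ) / ((B₄ + k : ℕ) : ℝ)) ^ s) B := by
  have hSr : (0 : ℝ) < S := by exact_mod_cast hS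
  obtain ⟨k, rfl⟩ : ∃ k, s = k + 1 := ⟨s - 1, by omega⟩
  have hk : 1 ≤ k := by omega
  unfold logTrigFarScaledBox at h
  split at h
  · rename_i Z L hZ hL
    split_ifs at h with hc
    obtain ⟨hσ, hσN⟩ := hc
    simp only [Option.some.injEq] at h
    subst h
    -- phase data and `σ ≤ |sin(φ/2)|`
    set z : ℂ := Complex.exp (I * φ) with hzdef
    have hz : MC.mem S z Z := by
      have := MC.mem_expI hS hpi hZ hφm
      rwa [mul_comm] at this
    have homz : MC.mem S (1 - z) ((MC.ofInt S 1).sub Z) := by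
      simpa using MC.mem_sub (MC.mem_ofInt S 1) hz
    have hNm := MC.mem_normSq hS homz
    have hns : Complex.normSq (1 - z) = (2 * |Real.sin (φ / 2)|) ^ 2 := by
      rw [Complex.normSq_eq_norm_sq, hzdef, norm_one_sub_cexp_I_mul]
    have hσR : (0 : ℝ) < (σ : ℝ) := by exact_mod_cast hσ
    have hσle : (σ : ℝ) ≤ |Real.sin (φ / 2)| := by
      have h1 : ((MC.normSq S ((MC.ofInt S 1).sub Z)).lo : ℝ) ≤ Complex.normSq (1 - z) * S := hNm.1
      have h2 : 4 * (σ : ℝ) ^ 2 * S ≤ ((MC.normSq S ((MC.ofInt S 1).sub Z)).lo : ℝ) := by exact_mod_cast hσN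
      rw [hns] at h1
      have h3 : (σ : ℝ) ^ 2 ≤ |Real.sin (φ / 2)| ^ 2 := by nlinarith
      exact (pow_le_pow_iff_left₀ hσR.le (abs_nonneg _) two_ne_zero).1 h3
    have hφ0 : Real.sin (φ / 2) ≠ 0 := by
      intro h0; rw [h0, abs_zero] at hσle; linarith
    -- the weight `W = log^i B₄ / B₄^{k+1} ≤ (L.hi/S)^i / B₄^{k+1}`
    have hlog := (MI.mem_logNat hS hL).2     -- log B₄ * S ≤ L.hi
    have hB1 : (1 : ℝ) ≤ B₄ := by exact_mod_cast (show 1 ≤ B₄ by omega)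
    have hlog0 : 0 ≤ Real.log B₄ := Real.log_nonneg hB1
    have hlogle : Real.log B₄ ≤ (L.hi : ℝ) / S := by rw [le_div_iff₀ hSr]; exact hlog
    have hW : Real.log (B₄ : ℝ) ^ i / (B₄ : ℝ) ^ (k + 1) ≤ ((L.hi : ℝ) / S) ^ i / (B₄ : ℝ) ^ (k + 1) :=
      div_le_div_of_nonneg_right (pow_le_pow_left₀ hlog0 hlogle i) (by positivity)
    -- the radius
    set R : ℚ := ((L.hi : ℚ) / S) ^ i * (m₀ : ℚ) ^ (k + 1) / ((B₄ : ℚ) ^ (k + 1) * σ) with hR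
    have hp : (0 : ℝ) ≤ (m₀ : ℝ) ^ (k + 1) := by positivity
    have hRge : (m₀ : ℝ) ^ (k + 1) * ((Real.log (B₄ : ℝ) ^ i / (B₄ : ℝ) ^ (k + 1)) / |Real.sin (φ / 2)|) ≤ (R : ℝ) := by
      have e : ((R : ℚ) : ℝ) = (m₀ : ℝ) ^ (k + 1) * ((((L.hi : ℝ) / S) ^ i / (B₄ : ℝ) ^ (k + 1)) / (σ : ℝ)) := by
        rw [hR]; push_cast; field_simp
      rw [e]
      refine mul_le_mul_of_nonneg_left ?_ hp
      have hWnn : 0 ≤ Real.log (B₄ : ℝ) ^ i / (B₄ : ℝ) ^ (k + 1) := by positivity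
      calc (Real.log (B₄ : ℝ) ^ i / (B₄ : ℝ) ^ (k + 1)) / |Real.sin (φ / 2)|
          ≤ (Real.log (B₄ : ℝ) ^ i / (B₄ : ℝ) ^ (k + 1)) / (σ : ℝ) :=
            div_le_div_of_nonneg_left hWnn hσR hσle
        _ ≤ (((L.hi : ℝ) / S) ^ i / (B₄ : ℝ) ^ (k + 1)) / (σ : ℝ) := div_le_div_of_nonneg_right hW hσR.le
    have hceil : ((R : ℝ)) * S ≤ ((⌈R * S⌉ : ℤ) : ℝ) := by
      have := Int.le_ceil (R * S); exact_mod_cast this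
    -- both tails: rescale, bound the inner sum, conclude
    have key : ∀ trig : ℝ → ℝ, (trig = Real.cos ∨ trig = Real.sin) →
        MI.mem S (∑' j : ℕ, Real.log ((B₄ + j : ℕ) : ℝ) ^ i * trig ((B₄ + j : ℕ) * φ)
          * ((m₀ : ℝ) / ((B₄ + j : ℕ) : ℝ)) ^ (k + 1)) ⟨-⌈R * S⌉, ⌈R * S⌉⟩ := by
      intro trig htrig
      have e : (fun j : ℕ ↦ Real.log ((B₄ + j : ℕ) : ℝ) ^ i * trig ((B₄ + j : ℕ) * φ)
            * ((m₀ : ℝ) / ((B₄ + j : ℕ) : ℝ)) ^ (k + 1))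
          = fun j : ℕ ↦ (m₀ : ℝ) ^ (k + 1) * (Real.log (((B₄ + j : ℕ)) : ℝ) ^ i / (((B₄ + j : ℕ)) : ℝ) ^ (k + 1)
            * trig ((((B₄ + j : ℕ)) : ℝ) * φ)) := by
        funext j; rw [div_pow]; ring
      rw [e, tsum_mul_left]
      have hT := abs_tsum_le_of_abs_sum_range_le (summable_logPow_trig (φ := φ) hk hB₄ hi trig htrig)
        (abs_sum_range_logPow_trig_le hφ0 hk (by omega) hi trig htrig)
      have habs : |(m₀ : ℝ) ^ (k + 1) * ∑' j : ℕ, Real.log (((B₄ + j : ℕ)) : ℝ) ^ i / (((B₄ + j : ℕ)) : ℝ) ^ (k + 1)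
          * trig ((((B₄ + j : ℕ)) : ℝ) * φ)| * S ≤ ((⌈R * S⌉ : ℤ) : ℝ) := by
        rw [abs_mul, abs_of_nonneg hp]
        exact (mul_le_mul_of_nonneg_right ((mul_le_mul_of_nonneg_left hT hp).trans hRge) hSr.le).trans hceil
      rw [← abs_of_pos hSr, ← abs_mul] at habs
      obtain ⟨h1, h2⟩ := abs_le.1 habs
      constructor
      · show (((-⌈R * S⌉ : ℤ)) : ℝ) ≤ _
        rw [Int.cast_neg]; linarith
      · show _ ≤ (((⌈R * S⌉ : ℤ)) : ℝ)
        linarith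
    exact ⟨key Real.cos (Or.inl rfl), key Real.sin (Or.inr rfl)⟩
  · simp at h

end CinfCoeff

end Summit.RiemannHypothesis.RiemannHypothesis.Theorems.WeilFormatC
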